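import Mathlib
import HarnessLib
import HarnessLib.Audit
import Summits.HubbardSuperconductivity.Statement
import Literature.MathematicalPhysics.QuantumLattice.DWaveSource
import Literature.MathematicalPhysics.QuantumLattice.XYOrder
import Literature.MathematicalPhysics.QuantumLattice.HubbardScaleReportCT
import Literature.MathematicalPhysics.QuantumLattice.SymmetricRegimeCertificateT
import Summits.HubbardSuperconductivity.HubbardSuperconductivity.Theorems.AposterioriCapRgAssembly
import Summits.HubbardSuperconductivity.HubbardSuperconductivity.Theorems.AposterioriCapRgFixedPointOfCertifiedChain
import HarnessLib.Audit.Status.Attr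

/-!
Route: AposterioriCapRg

DORMANT since 2026-08-24T04:19:53Z (reconciler: no traction for 6.5 d (last activity item-evidence-added at 2026-08-17T15:01:23Z); parked, not closed — `ledger route dormant route-HubbardSuperconductivity-AposterioriCapRg --off` to reac) — unstaffed, not closed; items shared with open routes are served there. `ledger route dormant <id> --off` reactivates.

THESIS X (it suffices to show; realises idea card aposteriori-order-criterion-cap-rg; revs 8–11 =
PROMOTE pass 2026-08-15: cruxes re-cut after the refuters' on-paper findings, η>0 engine re-based on
the large-stiffness duality lever, scale-count numbers corrected; rev 12 = ROUTE-REPAIR 2026-08-15: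
the CAP crux and its consumer re-anchored to a COUNTERTERMED frame after rattack-13882's
refuted-misstated verdict on stmt-13882; rev 14 = ROUTE-REPAIR 2026-08-16 after rattack-13960's
refuted-misstated verdict on stmt-13960 (M1: an 'accuracy' η₁ bounded the floored irrelevant part;
M2: ∀π∃Θ*): accuracy Θ := (c₀, w) only, ALL physical data incl. the irrelevant-part bound E₃ pinned
in ONE literal record π₀ shared by producer and consumer, conclusion over the CT-frame report D1″ —
evidence REPAIR_13960.md; rev 18–19 = ROUTE-REPAIR 2026-08-16 after rattack-14026's
refuted-misstated verdict on stmt-14026 (M1″: the full sup-norm degree sum of (i′b) is factorially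
divergent at every field radius): (i′b) DEGREE-TRUNCATED at m_max = 10 ∈ π₀, typed over D1′b-v3 —
evidence REPAIR_14026.md; rev 20 = ROUTE-REPAIR 2026-08-16 after rattack-14042-g2's
refuted-misstated verdict on stmt-14042 (over v2 its hypothesis was never instantiated, so C2 held
for any conclusion): C2 re-based on the v3 certificate at the SAME literal capRgCornerDataT as C1,
the tail/Banach-ball control at Λ* made C2's own first obligation rather than an interface clause,
`0 < D.numPatches` added — evidence REPAIR_14042.md; rev 33 = ROUTE-REPAIR 2026-08-16 (unused-crux,
views3 cone of `closes`): the rank-4 crux XYOrderOpennessLargeSpin DROPPED — a spin-model ANALOGUE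
(toy instance) of R's phase-sector content from which no hypothesis of `closes` follows; 0 glued / 1
dropped, closes untouched). At some FIXED moderate coupling and doping in the box U ∈ [2,3], δ ∈
[1/5,7/20] — proposal point moved to the corner (U,δ) = (3,1/5), where the Cooper scale is largest —
there is a chemical potential μ with grand-canonical tracial ground-state density → 1−δ such that
the Koma–Tasaki d-wave order parameter of the PURE model is positive (`HasDWaveOrder U μ`: pair
source h → 0⁺ AFTER L → ∞). X is DELIVERED in three typed-or-typable steps: (C1)
CapRgSymmetricCertificatePinned — a computer-assisted constructive RG (CAP-RG) at h = 0 from the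
bandwidth W = 8t down to a stopping scale Λ*, run in a COUNTERTERMED FRAME (renormalised band e_K =
ε − μ − K with K an even C4v trigonometric polynomial exhibited by the certificate, cutoff on e_K,
quadratic counterterm in the interaction slot — the same Hamiltonian, frame moved:
FeldmanSalmhoferTrubowitz1996, Salmhofer1998 p.26, BGM2006 Rem. 5–6; definition request D1′a
hubbardEffectiveActionCT), certifying in the a-posteriori format (Lanford1982Feigenbaum /
KochWittwer1994 / FiguerasHaroLuque2016: finitely many verified inequalities on a computable object,
here to every accuracy Θ = (c₀, w): Fermi-curve residual c₀, enclosure width w) at the LITERAL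
physical record π₀ of the corner (3,1/5) — frame weight r = 4 with coeffNorm ≤ 10, quartic bound E₁
= 4 and the degree-truncated weighted irrelevant-part bound E₃ = 32 at field radius h_r = 1/4 on
degrees 6–10 (both NOT small; no tail / Banach-ball clause in the interface — since rev 20 the tail
ball at Λ* is C2's own first obligation (kill (f) keeps the coordinated ball-interface move in
reserve)), slope allowance c₁ = 1/2, Stoner margin σ = 1/4 at every transfer momentum, field
strength ∈ [1/2, 2], Fermi-curve geometry (|∇e_K| ∈ [1/2,4], curvature ∈ [1/25,3], van Hove distance
≥ 1/2), Λ* ∈ [1/100, 3/10] — the Fermi-curve renormalisation condition to residual c₀Λ*, B1g Cooper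
dominance by a factor 2 among Cooper eigenvalues, and the WINDOW λ_d(Λ*) ∈ [1/8, 1/5] (K := Λ*/Λ_c =
e^{1/λ_d} ∈ [e⁵, e⁸], 7–11.5 dyadic scales above the one-loop B1g pole Λ_c) enclosed to width w;
(C2) SeededBrokenRegimeBoseFermiPinned — an h-UNIFORM Bose–Fermi THEOREM (∀ thresholds of R, ∃
accuracy (c₀, w), ∀ points of the box with the density clause: v3 certificate
symmetricRegimeCertificateT at the SAME literal π₀ᵀ = capRgCornerDataT ⇒ FIRST the tail ball
‖𝒢^K_{Λ*} − P‖ ≤ w₂ in an M-stable antisymmetric-kernel L¹–L^∞ norm from the model at the certified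
point, THEN …) taking the certified scale-Λ* action through an explicit Hubbard–Stratonovich pair
field (phase θ made an honest boson, Ward identities removing the 1/h tangential Cooper vertex of
any purely fermionic seeded flow, SalmhoferEtAl2004 §4.2; residual couplings ≤ 1/5, not a
constructive radius) down to ONE infrared scale Λ₀ ≤ Λ_c/30, producing a HubbardScaleData
certificate (stiffness, off-nodal gap, nodal velocities, remainder norm, mean-field density m₀ > 0)
against the COUNTERTERMED-frame report hubbardScaleReportCT (D1″), valid ∀ h ∈ (0,h₀] from some
L₀(h) on; (R) AposterioriOrderCriterionR — the a-posteriori theorem for T = 0 U(1) ORDER with NAMED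
thresholds (kStar, etaStar): certified enclosure + thresholds ⇒ dWaveOrderParameter U μ ≥ m₀/2. R's
η = 0 core is the Gaussian phase field in effective dimension 3 (IR-finite); its η > 0 PHASE-SECTOR
content — order of a (2+1)-dimensional U(1) phase model at LARGE stiffness (the only regime R uses;
physical ρ_s/Λ₀ ~ 10³) WITHOUT reflection positivity, through the Fröhlich–Spencer integer-current /
vortex-gas duality at effective temperature ∝ 1/stiffness, the class in which low-temperature LRO is
PROVED RP-free for classical abelian models in d = 3 (FrohlichSpencerCMP1982 as quoted in
DarioWu2020 Prop. 1.1; DarioWu2020 Thm 1; KennedyKing1986; Balaban1995–BalabanOcarroll1999) — is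
built INSIDE R, Hubbard-typed (crux chain of AposterioriOrderCriterionR). Its simplest spin-model
instance, the large-spin XY openness statement XYOrderOpennessLargeSpin (momentum-zero order of
xyTorus n + εW for n ≥ n₀ under every small U(1)-invariant, translation- and
site-inversion-covariant finite-range rule, in-plane moment ≥ ½ classical; typed, grounded,
refuter-vetted; rank-4 crux revs 9–32), is since rev 33 NO LONGER A ROUTE ITEM: R is typed over
hubbardScaleReportCT and no exact reduction of the scale-Λ₀ phase sector to a perturbed xyTorus
Hamiltonian exists (d-wave block pairs close no su(2) algebra; the fermion-induced phase couplings
are retarded and not finite-range; ε₀(n,r) is neither uniform nor explicit), so a glue item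
`XYOrderOpennessLargeSpin → AposterioriOrderCriterionR` could never invoke its hypothesis — R in
costume — and an analogue cannot be a hypothesis of the deciding theorem (D-0027 §2.1). The
statement stays recorded on the ledger (stmt-13895, moot since rev 33) and verbatim in the tree
(right-hand side of `xyOrderOpennessLargeSpin_iff` in Theorems/AposterioriCapRgDefs.lean;
Cruxes/XYOrderOpennessLargeSpin/Disproof.lean) as the engine's TOY INSTANCE and advisory falsifier
(kill (b)), with its dossier under Cruxes/XYOrderOpennessLargeSpin/ and
Theorems/XYOrderOpennessLargeSpin/Negative/. The all-spin form KlsOrderOpennessR (stmt-10206,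
contains the LSSY hard-core-boson problem) was dropped at rev 9. X → Statement through the
every-ground-state transfer on even tori (crux SsbToEvenTorusLro) and pure logic: DECIDING THEOREM
(rev 29, crux-only) closes : CapRgSymmetricCertificatePinned → SeededBrokenRegimeBoseFermiPinned →
AposterioriOrderCriterionR → SsbToEvenTorusLro → HubbardSuperconductivity (certified, authority
native; X is derived inline — the same logic as support FixedPointOfCertifiedChain); since rev 33
every crux of the route is a hypothesis of closes.
Lean (one line, elaborated rc 0): ∃ U ∈ Set.Icc (2:ℝ) 3, ∃ δ ∈ Set.Icc (1/5:ℝ) (7/20), ∃ μ : ℝ,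
Filter.Tendsto (fun L : ℕ => ((Literature.MathematicalPhysics.QuantumLattice.hubbardTorusWith 2 (L +
1) 1 U μ).groundStateFunctional Literature.MathematicalPhysics.QuantumLattice.totalNumber).re / ((L
+ 1 : ℕ) : ℝ) ^ 2) Filter.atTop (nhds (1 - δ)) ∧
Literature.MathematicalPhysics.QuantumLattice.HasDWaveOrder U μ

Rationale: WHY THIS LINE. (card aposteriori-order-criterion-cap-rg; catalogue: certified computation +
multiscale analysis + a duality TRANSPLANT, with explicit dictionaries.) Every asymptotic
weak-coupling route must run 1/U² → ∞ RG steps with uniform constants through the Cooper logarithm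
(Literature.Barriers.HubbardSuperconductivity.WeakCouplingCeiling); at ONE fixed moderate point the
flow from the bandwidth to the pairing scale is finitely many dyadic scales (≈ 18–22 at the corner
(U,δ) = (3,1/5) by one-loop N-patch estimates, ≥ 30 deeper in the box — NUMBERS), so "for all small
U" is replaced by a VERIFIED FINITE COMPUTATION in the a-posteriori format of Lanford1982Feigenbaum
/ KochWittwer1994 / FiguerasHaroLuque2016 Thm 2.5 (finitely many certified inequalities on a
computable object): Salmhofer1998's discrete RG with explicit Gram/sector constants
(PedraSalmhofer2008, DisertoriRivasseau2000, FeldmanKnorrerTrubowitz2004) and interval arithmetic,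
run in a COUNTERTERMED FRAME e_K = ε − μ − K that keeps the physical Fermi curve under the cutoff
(FeldmanSalmhoferTrubowitz1996; Salmhofer1998 p.26 'a Wick ordering covariance which already
contains part of the self-energy'; BGM2006 Rem. 5–6; rev 12, after refuter rattack-13882 showed the
bare-band anchoring integrates the physical curve out with no IR cutoff) — crux
CapRgSymmetricCertificateCT, h = 0, down to a stopping scale Λ* inside the window λ_d(Λ*) ∈ [1/8,
1/5] only (Salmhofer1998 p.26 on the Hubbard model: above the curvature scale 'the geometry of the
Fermi surface provides no justification of restricting to the ladder flow … to get to scale μ̃, one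
has to calculate the effective action' — that calculation, certified, IS this crux). Below Λ* the
symmetry-breaking regime is NOT a computation but an h-uniform Bose–Fermi THEOREM with an explicit
Hubbard–Stratonovich pair field (crux SeededBrokenRegimeBoseFermiCT: the refuters showed that any
purely fermionic seeded flow has a tangential Cooper vertex ∝ 1/h, SalmhoferEtAl2004 §4.2,
EberleinMetzner2014 §III, so the phase MUST be a field, protected by Ward identities), delivering a
HubbardScaleData certificate at ONE scale Λ₀ = Λ_c/30 to the one conceptual theorem R (crux
AposterioriOrderCriterionR): T = 0 U(1) order is DECIDABLE from finitely many certified numbers at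
one scale — stiffness/(Λ₀·velocity) ≥ kStar, off-nodal gap ≥ 10Λ₀, remainder ≤ etaStar ⇒ order
parameter ≥ ½ mean field (gapped analogues: Knabe1988, GossetMozgunov2016). THE LEVER that makes R's
η > 0 content a mechanism and not a hope (this rev): R only ever works at LARGE stiffness ratio
(kStar ≫ 1; physically ρ_s/Λ₀ ~ t/Δ_d ~ 10³), never at the strongly-fluctuating Kennedy–Lieb–Shastry
point; in that corner the T = 0 problem in d = 2 is, through the S^z-basis world-line representation
(xyTorus is stoquastic: tree Matrix.groundProj_apply_nonneg) and the Fröhlich–Spencer duality, an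
abelian INTEGER-CURRENT / VORTEX GAS in effective dimension 3 at effective temperature ∝
1/stiffness, with U(1) invariance = local neutrality and site-inversion symmetry = evenness of the
dual potential (no linear drift — precisely the term the helical/DM witness
Theorems.AposterioriCapRgKlsOrderOpenness_refuted switches on); this is the class where
low-temperature LRO is PROVED WITHOUT reflection positivity for classical models
(FrohlichSpencerCMP1982 — 3-d Villain, Gaussian two-sided bounds, quoted as DarioWu2020 Prop. 1.1;
DarioWu2020 Thm 1, quantitative and "robust … general finite range interactions" p. 7;
KennedyKing1986, abelian Higgs by polymer expansion; Balaban1995–Balaban1998 + BalabanOcarroll1999,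
low-temperature RG for N-vector models; GarbanSepulveda2023), versus the RP-only status of the
quantum problem recorded in LSSY2005 §11.1 p. 117, Tasaki2019Tower §3.2 and GiulianiOtt2025 §1
("methods … capable of controlling the low-temperature series for the magnetization of … the 3D
quantum XY model" named there as an open long-term goal). The lever is exercised INSIDE R,
Hubbard-typed (crux chain of AposterioriOrderCriterionR); its simplest typed spin-model instance
XYOrderOpennessLargeSpin (spin n/2 ≥ n₀/2: 1/n is the temperature; rank-4 crux revs 9–32) was
DROPPED at rev 33 by the unused-crux repair — an analogue is not a hypothesis of the deciding
theorem (D-0027 §2.1) and no honest glue XY → R exists (RANKED CRUXES [4]) — and stays recorded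
(ledger stmt-13895, moot; verbatim as the right-hand side of `xyOrderOpennessLargeSpin_iff` in
Theorems/AposterioriCapRgDefs.lean) as R's toy instance; the all-spin statement KlsOrderOpennessR
(stmt-10206), which contains BEC of 2-d hard-core bosons off half filling (LSSY open problem; the
AtomisticToContinuum barrier HalfFillingReflectionPositivity), is dropped from this route as not
load-bearing — R never needs n = 1.
RANKED CRUXES. [2] CapRgSymmetricCertificatePinned (rev 14/18; informal until D1′b-v3
defn-symmetricRegimeCertificateT lands — v2 symmetricRegimeCertificateR landed p72167 with the
UNTRUNCATED (i′b) and is dead at U > 0 by rattack-14026 M1″ (REPAIR_14026.md); v3 = v2 +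
degree-truncated (i′b), elaborating prototype Sketch.lean rc 0 with the typed [2],[3],[5] and the
proved glue; supersedes CapRgSymmetricCertificateCT = stmt-13959, whose ∀Θ ranged over an 'accuracy'
η₁ bounding the floored irrelevant part — rattack-13960 T9/M1 — and, before it, stmt-13882,
refuted-MISSTATED by rattack-13882: bare-band frame) — h = 0 CAP in the countertermed frame AT THE
PINNED INTERFACE: ∃ (U,δ,μ) with density → 1−δ, ∀ accuracy Θ = (c₀, w) > 0, ∃ frame K : TrigPolyC4v,
Λ*, L₀ with symmetricRegimeCertificate U μ π₀ ⟨c₀,w⟩ K Λ* L₀, π₀ the ONE LITERAL physical record of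
the corner (NUMBERS; REPAIR_13960.md §3): ∀L≥L₀ ∃β₀ ∀β ∃M₀ ∀M: normaliser ≠ 0, Fermi-curve condition
≤ c₀Λ* on the Λ*-shell of {e_K = 0} up to the slope allowance c₁|e_K| (c₁ = 1/2), field strength ∈
[1/2, 2], π₀'s geometry, ‖𝒱₄‖ ≤ E₁ = 4 AND the DEGREE-TRUNCATED weighted irrelevant part
ρ^{≤m_max}_{Λ*} ≤ E₃ = 32 at field radius h_r = 1/4 with m_max = 10 ∈ π₀ (rev 18, rattack-14026 M1″
/ repair C‴), i.e. Σ_{m ≤ 10, m∉{0,2,4}} h_r^{m−4}Λ*^{(m−4)/2}‖𝒱_m‖_∞ = remainderWeightNormUpTo at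
h_r²Λ* ≤ 32 — by parity a bound on ‖𝒱₆‖, ‖𝒱₈‖, ‖𝒱₁₀‖ only (tree value n!U^n h_r^{2n−2}: 1.125 +
0.633 + 0.475 ≈ 2.2; the FULL sup-norm degree sum is factorially divergent at every radius because
the sorted-monomial coefficient counts the n! spectator orderings of zero-transfer forward
scattering coherently — NOT a tail or Banach-ball bound, REPAIR_14026.md §3; both E₁, E₃ FIXED and
NOT small), B1g lowest Cooper eigenvalue with every other ≥ −λ_d/2 and Stoner products ≤ 3/4 at
every q (ONE normalisation: D1′b v1's sup norms of vertex functions, M-stable degree by degree;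
predicate v3), ENCLOSURE λ_d(Λ*) ∈ [a,b] ⊂ [1/8,1/5] with b − a ≤ w and a, b bound outside the L, β,
M quantifiers (why it might fail: explicit 2-d sector/determinant constants may not certify the M →
∞ / L → ∞ stability of ANY clause at U = 3 — printed radii |U| ≲ 10⁻²–10⁻³, nodal curvature 0.076
inflates sector constants; (i′b)-v3 hands [3] no control of degrees ≥ 12 — since rev 20 the tail
ball at Λ* is [3]'s own first obligation (TailBallAtScale), and only if that provably needs the
computer does a ball clause in a sectorised norm nobody has sized enter the interface (fallback β,
kill (f)); inside the window the (π,π)/incommensurate Stoner products may exceed 3/4 (indicative RPA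
U·χ₀ = 1.22, screened ≈ 0.8–0.9 at the corner) or d_xy/s± break the factor 2; second-order λ_d⁰(3,
0.8) ≈ 0.044 sits at kill (a)'s edge; (0d) on the whole shell effectively confines Λ* to [0.01,
0.19] at the corner; sources Salmhofer1998, FeldmanSalmhoferTrubowitz1996, PedraSalmhofer2008,
DisertoriRivasseau2000, DengEtAl2015 p. 3, HalbothMetzner2000, rattack-14026 ATTACK_14026.md). What
∀Θ still asserts (g47-2 (b), much milder after the repair): the exact frame is approximable within
coeffNorm₄ ≤ 10 uniformly in large L, β, M (∀c₀) and the thermodynamic-limit λ_d(Λ*) is certified to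
every precision (∀w) — the tail theorem (explicit Gram/sector constants at the point, M → ∞) that
every M-stable clause already needs. Most informative per unit cost and home of kills (a), (a′),
(d): rank 2. [3] SeededBrokenRegimeBoseFermiPinned (rev 20 = ROUTE-REPAIR after refuter
rattack-14042-g2's refuted-MISSTATED verdict: typed over v2 the hypothesis
symmetricRegimeCertificateR … capRgCornerData … was never instantiated — rattack-14026 M1″ one level
down — so [3] held for ANY conclusion (W.lean S3_of_factorialFloor); REPAIR_14042.md: hypothesis
RE-BASED on the v3 certificate at the SAME literal capRgCornerDataT as [2] (ONE predicate, ONE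
literal, glue by logic — seat 24c32d83's v3 adopted, no competing definition), conclusion tail
verbatim + `0 < D.numPatches` (g2 C1: a 0-patch datum frees v_F, v_Δ), and the consumer-side norm g2
asks for (antisymmetric-kernel L¹–L^∞ with field radius, NOT truncation alone) made [3]'s explicit
FIRST OBLIGATION instead of an interface clause (an interface ball forces a coordinated restatement
of [2] = kill (f)'s one move, reserved); typed shape Item3T + the one-liner `item3T_oneLiner_iff` in
the rev-20 Sketch.lean of the 14042 seat, rc 0 with the glue re-proved, set as signature at
definition-landed; lineage: repaired stmt-13960, rattack-13960 M1/M2, C′) — ∀ kStar etaStar > 0, ∃ Θ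
= (c₀, w), ∀ U ∈ [2,3] δ ∈ [1/5,7/20] μ (density → 1−δ) K Λ* L₀: symmetricRegimeCertificateT U μ
capRgCornerDataT Θ K Λ* L₀ ⇒ ∃ h₀ > 0, ∃ D : HubbardScaleData with D.MeetsThresholds kStar etaStar,
0 < D.numPatches, 0 < m₀.fst and ∀ h ∈ (0,h₀] ∃ L₀′, D.IsCertifiedEnclosure (hubbardScaleReportCT U
μ D h) L₀′. WHAT THE HYPOTHESIS IS: finite data — sup norms of the δ-stripped vertex functions of
degrees 4, 6, 8, 10 at Λ*, the two-point renormalisation conditions on the shell, the Cooper/Stoner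
spectral clauses, the window; it is NOT a bound on 𝒢^K_{Λ*} in a norm a multiscale argument
propagates. FIRST OBLIGATION (TailBallAtScale, Theses-side, typable today — Sketch.lean §4 rc 0;
foreseen first child of the split): from the MODEL hubbardEffectiveActionCT L M β U μ 0 K Λ* at the
certified point, 𝒢^K_{Λ*} lies for all large L, β, M in a ball ‖𝒢^K_{Λ*} − P‖ ≤ w₂ around an
exhibited polynomial action P of degree ≤ m_max in the leg-weighted (below-scale CT cutoff weight
√(1 − w^K_{Λ*}) on every leg, compact support ⇒ M-stable, the device of D1″), radius-weighted
ANTISYMMETRIC-KERNEL L¹–L^∞ norm ctActionNormBelow = Σ_{m∉{0,2,4}} h_r^m · legKernelNorm ε m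
(weightedKernel ε 𝒢 m) (Salmhofer1998 §4.1 / GK convention, which carries the 1/m! that v1's 𝒱_m
lacks: the n!·Uⁿ witness is n!Uⁿ/(2n+2)! there), sectorised as the proof requires (rev 18's size
estimate: an unsectorised ball has tree radius ∝ Λ*^{3/4}); THEN HS-decouple the certified B1g block
at Λ*, integrate phase boson + amplitude + fermions through Λ_c to Λ₀ ≤ Λ_c/30 into the
phase–quasiparticle normal form; honest small parameters (c₀, w), w₂ (its own theorem), residual
couplings ≤ 1/5, σ = 1/4, Λ₀/Λ*, symmetric flow ≤ 11.5 dyadic scales; NOT small: E₁ = 4, E₃ = 32 at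
h_r = 1/4 on degrees ≤ 10, c₁ = 1/2, forward Landau couplings, and U = 3 itself inside the tail
obligation; the theorem may re-choose its frame below Λ* (D1″ binds the frame inside the report) and
chooses D after the certified point (why: no constructive control of continuous SSB with a Goldstone
mode exists for any short-range Fermi-surface system — Kashima2021ImaginaryFieldBCS needs the
reduced BCS interaction, BFKT2017's broken-phase stage is unfinished; the tail ball must be PROVED
at U = 3 with no printed radius (GiulianiMastropietroRychkov2021 §8.1.5, PedraSalmhofer2008) — if it
provably needs the computer, kill (f)'s one coordinated move puts it in the interface (fallback β);
E₁, E₃ are no constructive radius; σ = 1/4 at Λ* may not stop AF feedback over 5–8 e-folds; first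
lemma of the flow = the Ward identity making every θ-coupling a derivative coupling after ψ ↦
e^{iθ/2}ψ, SalmhoferEtAl2004 §4.2, EberleinMetzner2014 §III; typing caveats T2–T4 of rattack-13883
and T7 of rattack-13960 carried). Hardest: rank 3. [4] VACANT since rev 33 (ROUTE-REPAIR,
unused-crux). XYOrderOpennessLargeSpin (stmt-13895: ∃ n₀ ≥ 1 ∀ n ≥ n₀ ∀ r ∃ ε₀(n,r) > 0, every
family of range-r local rules — Hermitian with spectrum in [−1,1], U(1)-invariant, translation- and
site-inversion-covariant — at |ε| ≤ ε₀ leaves the tracial ground states of xyTorus 2 (2k) n + εW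
with Σ_{x,y} Re ω(S⁰_xS⁰_y + S¹_xS¹_y) ≥ ¼(n/2)²(2k)⁴ eventually in k; typed rev 9, grounded g30
'NEW — no print', vetted g47-2/g48-0, crux-attack rattack-13895 survived, standing disproof
Cruxes/XYOrderOpennessLargeSpin/Disproof.lean with the landed tightness trio
Theorems/XYOrderOpennessLargeSpin/Negative/FalseWithoutCovariance.lean — false without the norm
bound / translation / inversion clauses —, 8 crux ideas, triage ×3, PICKED line feynman-sector-gap,
vocabulary Theorems/AposterioriCapRgDefs.lean with xyOrderOpennessLargeSpin_iff) was DROPPED because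
it is the spin-model INSTANCE of R's conclusion ('moment ≥ ½ classical under small symmetric
perturbations at large stiffness'), not a statement from which any hypothesis of closes ([2], [3],
R, [5′]) follows: R is typed over hubbardScaleReportCT, and the only candidate glue
`XYOrderOpennessLargeSpin → AposterioriOrderCriterionR` could never INVOKE its hypothesis — there is
no exact reduction of the Hubbard scale-Λ₀ phase sector to a perturbed xyTorus Hamiltonian (d-wave
block pairs close no su(2) algebra; the fermion-induced phase couplings are retarded with
exponential tails, not finite-range rules of spectrum [−1,1]; ε₀(n,r) is neither uniform in n nor
explicit, so no deformation argument chains it), and no U(1)-symmetric correlation-comparison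
inequality is known for quantum XY / fermion pair fields (BenassiLeesUeltschi2016: Ginibre only at
fixed sign) — i.e. the glue would be R in costume, which this route does not file. The statement
(verbatim on the ledger as stmt-13895, moot, and in the tree as the right-hand side of
`xyOrderOpennessLargeSpin_iff` in Theorems/AposterioriCapRgDefs.lean — a landed file that names the
dropped decl and must be vendored or retired by the operator, TREE_WARNING.md on the route; dropped
open items are not echoed in the route file's inactive record) remains the recommended TOY INSTANCE
and cheapest laboratory for R's η > 0 engine and an ADVISORY falsifier (kill (b)); whoever builds
R's phase-sector step reads that dossier first. Cruxes are now four: ranks 2, 3, 5, 5. [5]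
AposterioriOrderCriterionR (informal; D1 hubbardScaleReport landed as BARE-frame v1 (p70233, its own
UPSTREAM caveat), so R is to be typed over the CT-frame report D1″ hubbardScaleReportCT — frame
∃-bound inside, patches on {e_K = 0} — and its typed SHAPE is unchanged, evidence FRAME_NOTE.md +
REPAIR_13960.md §5 on stmt-13884; repaired stmt-1381: quantifier ∀h ∃L₀, Hubbard-typed hence
parity-covariant, NAMED thresholds ∃-bound in R and met ∀-uniformly by [3], m₀.fst > 0, 0 < h₀) — R
itself: ∃ kStar etaStar > 0, ∀ U μ h₀ D, 0 < h₀ → (∀ h ∈ Ioc 0 h₀, ∃ L₀, D.IsCertifiedEnclosure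
(hubbardScaleReportCT U μ D h) L₀) → D.MeetsThresholds kStar etaStar → m₀.fst/2 ≤
dWaveOrderParameter U μ (why: no a-posteriori criterion for GAPLESS U(1) order exists in print; the
nodal Dirac–Goldstone IR is non-Gaussian; constants may force kStar beyond what [3] certifies). [5′]
SsbToEvenTorusLro (typed, unchanged, ledger rank 5) — Koma–Tasaki SSB + density ⇒ d-wave pair-field
LRO of EVERY (N_L, S^z = 0)-sector ground state on even tori (why: tower mixing / degenerate
sectors, LROForcesLowLyingStates; KomaTasaki1994 prove only LRO ⇒ SSB). Target [0]
FixedPointDWaveOrder (typed, unchanged). DECIDING THEOREM closes : FixedPointDWaveOrder →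
SsbToEvenTorusLro → HubbardSuperconductivity (8 lines of logic, certified, authority native);
Assembly := SsbToEvenTorusLro → FixedPointDWaveOrder → HubbardSuperconductivity (typed). Typed glue
into the target, CHECKED over the v3 prototype and the landed D1″ (rev-18 and rev-20 Sketch.lean
`fixedPoint_of_items`, rc 0): CapRgSymmetricCertificatePinned → SeededBrokenRegimeBoseFermiPinned →
AposterioriOrderCriterionR → FixedPointDWaveOrder ([2] gives (U,δ,μ,density) and F := ∀(c₀,w)
∃(K,Λ*,L₀) Cert at π₀; R supplies (kStar, etaStar); [3] at (kStar, etaStar) supplies (c₀,w); F gives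
the certificate; [3] returns h₀, D with m₀ > 0; R returns m₀/2 ≤ dWaveOrderParameter;
hasDWaveOrder_iff) — producer-∀/consumer-∃ on accuracy, ONE literal π₀ on both sides (no ∀π/∃π),
shared window: no information-free hypothesis, no unglued ∃, no floor (the refuter's floor_pathology
is re-run against the landed D1′b at set-signature).
KILL CRITERIA. (a) certified NON-contraction of the remainder map at the first nontrivial scale Λ₁/2
for U = 2 in the dressed frame with optimised norms, or a certified λ_d(3, 0.8) ≤ 0.05 at second
order (window unreachable above ~10⁻⁹, L₀ ≳ 10⁹): closes the route as
infeasible-with-present-constants (census = the measured constant gap — a number nobody has); (a′)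
NO FRAME: the certified counterterm iteration K ↦ Re Σ^K_{Λ*} on the shell does not close at the
corner (Fermi-curve condition c₀ unreachable — reconstruction / Lifshitz point near the corner's μ)
⇒ move the point inside the box once, else close; (b) ADVISORY since rev 33 (the statement is no
longer an item, so this is evidence for the tenure planner, not a gate event): a counterexample to
the recorded large-spin XY openness statement XYOrderOpennessLargeSpin — a parity-even,
U(1)-invariant, bounded finite-range rule destroying (not displacing) momentum-0 XY order at
arbitrarily small ε for arbitrarily LARGE spin — discredits R(η>0) in its easiest corner; the tenure
planner then retires the route by hand (close exhausted / refuted:AposterioriOrderCriterionR once R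
falls) unless R's provers exhibit a Hubbard-specific mechanism, and the duality lever is withdrawn
from cards plaquette-boson-kls-anchor / goldstone-stable-continuation; the helical/DM witness
against 1314 and the three clause-dropping witnesses of Negative/FalseWithoutCovariance.lean are not
of this kind (inversion-odd / translation-breaking / unbounded: order displaced or the class left,
not destroyed inside it); (c) SsbToEvenTorusLro refuted inside the Hubbard family ⇒ pivot to a
uniqueness / generic-U restatement, not closure; (d) a theorem excluding d_{x²−y²} order on the
whole box (a competing (π,π)/incommensurate instability — Stoner product ≥ 1 — or a non-B1g leading
Cooper eigenvalue certified at every point of the box inside the window: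
CapRgSymmetricCertificatePinned's clause (ii′) run in reverse) ⇒ close; (e) a proof that the Ward
identities do NOT remove the 1/h phase vertex in the HS-decoupled flow
(SeededBrokenRegimeBoseFermiPinned's first lemma false) ⇒ the seeded architecture is dead; pivot to
an h = 0 ODLRO criterion or close; (f) INTERFACE: if [3] provably needs residual couplings < 1/5
(window upper end) or a sharper π₀ entry (σ, E₁, E₃, ζ, geometry) or a Banach-ball clause on 𝒢_{Λ*}
(fallback β — NOT spent at rev 20: [3] is typed over the v3 certificate alone and carries the ball
as its internal obligation TailBallAtScale in the now-concrete norm ctActionNormBelow; β is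
triggered only if [3]'s provers show the ball must come certified from the CAP), or [2]'s dominance
provably sets in only below λ_d = 1/5 or [2] certifies the point but misses a π₀ numeral, the window
/ π₀ is moved ONCE by a coordinated restatement of [2]+[3] (transcribing π₀ into D1′b's landed
normalisation at set-signature is not that move, REPAIR_13960.md §3); a second failure closes the
route (the tension g47-1 (2) is then the physics, not the statement).
NOT DECOMPOSED YET. Inside R's η > 0 phase sector (formerly 'inside [4]'; since rev 33 R's own
business, to be run on the Hubbard-derived scale-Λ₀ phase action — retarded, exponentially decaying
couplings — with the recorded xyTorus statement as the toy on which to debug it): the three-step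
duality line (i) exact current/vortex (Fröhlich–Spencer) rewriting of ⟨S⁺_xS⁻_y⟩ for xyTorus n + εW
at T = 0 as a ratio of (2+1)-d integer-current ensembles with log-concave weights and complex
ε-activities (WallinEtAl1994 J-currents; loop representations Ueltschi2013 Thm 3.3), (ii) the
ANISOTROPIC VILLAIN LEMMA — FS's lower bound ⟨cos(θ₀−θ_x)⟩ ≥ exp(−C/β_eff) for the Villain model on
ℤ²×ℤ with couplings (β_s,β_τ), uniformly in β_τ/β_s → ∞ at fixed β_eff = √(β_sβ_τ) ≥ β₀ (the
Monday-morning lemma; needs a definition of the anisotropic Villain measure; precedent for the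
time-continuum step BalabanEtAl2010), (iii) cluster expansion of the ε-activities and of the
non-Villain weight corrections around the renormalised vortex gas (DarioWu2020 Ch. 3–4 format) —
foreseen as the phase-sector half of the first glued split of R once (ii) is typed (TWO-LAYER PLAN).
Inside [3]: FIRST the tail ball at Λ* (TailBallAtScale — ∃ w₂ ∀L≥L₀ ∃β₀ ∀β ∃M₀ ∀M ∃ P of degree ≤
m_max, ctActionNormBelow(𝒢^K_{Λ*} − P) ≤ w₂ at h_r = π₀.fieldRadius; its sectorisation and
natural-size weights are the obligation's to fix), then amplitude/off-nodal integration (gapped, FKT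
sectors) vs the θ–nodal system (C3′ nodal package: Dirac cones couple to ∂θ only, irrelevant by
power counting). Inside [2]: the certificate format (interval enclosures of G₂, G₄ on N_p sectors of
{e_K = 0}, the counterterm fixed-point iteration for K) vs the analytic tail bounds
(Gram/determinant constants, M → ∞); the NORM of a future ball clause (rev 18: momentum sup norms
are factorial in the degree, momentum L¹ norms fail M-stability through the log M ultraviolet tail,
unsectorised position-space L¹–L^∞ norms have tree radius ∝ Λ*^{3/4}, ≈ (1/40)√Λ* at Λ* = 1/100 —
informative only in a sectorised norm, DisertoriRivasseau2000 / BenfattoGiulianiMastropietro2006);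
and the DENSITY CLAUSE (existence of the L → ∞ grand-canonical ground-state density at the certified
μ and its value 1−δ — asserted inside [2] as before, a thermodynamic-limit sub-task that may split
off as support). Canonical ↔ grand-canonical equivalence inside [5′]. Numerical values of kStar,
etaStar (fixed by whoever proves R; [3] is ∀-uniform in them). Two interface fallbacks recorded, not
filed (REPAIR_13960.md §6): (α) the FULLY LITERAL interface — R at literal thresholds, [3] at a
literal accuracy Θ₀, [2] := ∃ K Λ* L₀ Cert π₀ Θ₀ (no ∀Θ at all); (β) R1b — accuracy = ENCLOSURE
RADIUS ‖𝒢_{Λ*} − P‖ of a computed polynomial action P exhibited by the certificate and consumed by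
[3], in [3]'s sectorised norm; (β) was at rev 18 the EXPECTED shape of the coordinated typing of
[2]+[3] (the truncated (i′b) carries no tail); rev 20 (the [3] seat, REPAIR_14042.md §2: one
predicate or no glue) types [3] over the v3 certificate ALONE, moves the ball inside [3] as
TailBallAtScale with the norm made concrete (ctActionNormBelow, inline over legKernelNorm /
weightedKernel / hubbardCutoffWeightCT — no Literature definition needed), and keeps (β) as kill
(f)'s reserved move; (α) becomes a revision if ∀(c₀,w) is attacked as an unprovable convergence
claim.
CHEAPEST FALSIFIER. For the line: kills (a)/(a′) as a kit-compute interval-arithmetic job —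
certified Hartree + second-order frame K at (3, 0.8) (does the counterterm iteration close?), the
one-loop-plus-remainder contraction test at Λ₁/2, U = 2 in that frame, and the certified λ_d(3, 0.8)
with second-order (Kohn–Luttinger + particle–hole) vertex on N_p = 32 sectors of {e_K = 0} plus the
Stoner products at Λ* = 0.1: a day of interval arithmetic once D1′b fixes the normalisation; λ_d ≤
0.05 or a Stoner product ≥ 1 at the corner kills the point, a Stoner product in (3/4, 1) or the
truncated ρ^{≤10}(h_r = 1/4) far above 32 (or needing h_r < 1/8 / m_max < 10), or no certifiable Λ*
≤ 0.19, triggers the one π₀ move of kill (f). For R's η > 0 engine at toy level (advisory kill (b);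
formerly 'for crux [4]'): linear spin-wave theory of xyTorus n + εW for the simplest parity-even
T-odd and frustrating rules (r ≤ 2) — an instability of the q = 0 in-plane ferromagnet at O(ε)
uniformly in n (a soft mode at q ≠ 0 whose stiffness correction does not scale with n²) would refute
the (n/2)²/4 constant cheaply; none is expected since parity makes the spiral energy even in q and
the classical exchange scale is n²/4 ≫ ε.
TWO-LAYER PLAN. R ⇐ PhaseSectorDualityOrder (the (2+1)-d large-stiffness U(1) engine on the
Hubbard-derived phase action: anisotropic Villain lemma (ii) + current representation and cluster
expansion (i)+(iii)) → QuasiparticleIntegration (gapped amplitude/off-nodal modes + ∂θ-coupled nodal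
Dirac fermions, power-counting irrelevant) → AposterioriOrderCriterionR (k = 2, foreseen once the
anisotropic Villain measure and a phase-action vocabulary are defined; replaces the rev-9 plan '[4]
⇐ AnisotropicVillainLRO → CurrentRepresentationTransfer', retired with [4]). [3] ⇐
TailBallAtLambdaStar → WardIdentityPhaseVertex → BrokenRegimeFlowToLambda0 →
SeededBrokenRegimeBoseFermiPinned (k = 3). No third layer.
NUMBERS. Scale count log₂(W/Λ₀), W = 8t, Λ₀ = Λ_c/30, Λ_c = c·E_F·e^{−1/λ_d}: controlled BDMC gives
λ_d ≈ 0.1, T_c/E_F ≈ 5·10⁻⁵ only at (U,n) = (4,0.7), outside the box (DengEtAl2015 p. 3: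
"λ_{d_{x²−y²}} ~ 0.1 corresponding to a critical temperature T_c/E_F ~ 5×10⁻⁵"); inside U ≤ 3 their
λ_d is smaller (it "increases rapidly as n and U are increased"), ≈ 0.03–0.07 for n ≤ 0.7 ⇒ Λ_c/t ≈
10⁻⁶–10⁻¹⁴, 25–50 scales at δ ≥ 0.3 — the card's "10–15" is withdrawn; at the corner (3, 0.8)
one-loop N-patch flows (HalbothMetzner2000, HonerkampEtAl2001; uncontrolled at U = 3, t′ = 0) give
Λ_c/t ~ 10⁻³–10⁻⁴, i.e. ≈ 18–22 scales and L₀ ≳ v_F/Λ₀ ~ 10⁵–10⁶. Where the CAP stops (rev 12: a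
WINDOW, not a constructive radius — refuter F2: the full quartic norm at U = 3 is O(U) in any frame,
U·N_F ≈ 0.55, kernel sup 3): the B1g eigenvalue λ_d(Λ) = λ_d⁰/(1 − λ_d⁰ log(W′/Λ)) is certified
inside [1/8, 1/5] at Λ*, so K = Λ*/Λ_c = e^{1/λ_d(Λ*)} ∈ [e⁵, e⁸] ≈ [148, 2981], i.e. 7–11.5 dyadic
scales above Λ_c (upper end 1/5 = the old ε₁ = 0.2: residual couplings handed to [3] after the HS
step ≤ 1/5, rattack-13883 T1 'ln K ≫ 1'; lower end 1/8: [3]'s symmetric flow stays ≤ 11.5 dyadic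
scales, so [3] is not a weak-coupling-asymptotic statement; 1/20 would mean K ≈ 5·10⁸, hopeless) —
with Λ_c/t ~ 10⁻³–10⁻⁴ this puts Λ* ≈ 0.015–0.3, where B1g dominance among Cooper eigenvalues is
plausible and the Stoner margins are the live risk; the certificate covers W → Λ* (≈ 5–9 dyadic
scales) and the Bose–Fermi theorem the remaining log₂(30K) ≈ 12–16.5; this is why the HS decoupling
happens while the channel is still WEAK. Frame numbers at the corner (rattack-13882): model μ ∈
[0.4, 0.8] (Hartree +0.77 over μ₀(0.8) ≈ −0.43), so K ≈ −0.77 + O(U²) anisotropy and {e_K = 0} is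
the curve enclosing filling 0.8, not the free curve at μ (filling 1.2–1.3). THE PINNED RECORD π₀
(rev 14, t = 1, t′ = 0, corner (3, 1/5), free-band checks at n = 0.8: μ₀ = −0.427, |∇ε| ∈ [1.235,
2.812] on the curve, curvature ∈ [0.076, 1.62], van Hove distance 0.666, U·N_F = 0.56): frame weight
r = 4 with coeffNorm ≤ 10; E₁ = 4 (norm-U units); E₃ = 32 at field radius h_r = 1/4 on degrees m ≤
m_max = 10 (rev 18; tree level Λ^{n−1}‖𝒱_{2n+2}‖_∞ ≈ n!·U^n in D1′b's normalisation —
rattack-14026's exact Wick count 2, 6, 24, the rev-16 figure ½(2U)^{m/2−1} undercounted the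
spectator orderings — ⇒ terms 1.125, 0.633, 0.475, truncated sum ≈ 2.2, headroom ×14 for loop
dressing; minimal term near m ≈ 10–12, factorial regrowth beyond, the full sum passes 32 at m = 28
for every L ≥ 2, M ≥ 1: hence the truncation; still the least certain entries); c₁ = 1/2; σ = 1/4; ζ
= 1/2; |∇e_K| ∈ [1/2, 4]; curvature ∈ [1/25, 3]; d_vH ≥ 1/2; Λ* ∈ [1/100, 3/10] (effective: (0d) on
the whole continuum shell of the near-free frame fails for Λ* ≳ 0.19 at the corner — d_vH = 0.481 at
e = +0.2, κ_min = 0.022 at e = +0.3, rattack-14026 shell_geometry.py — so the CAP must stop in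
[0.01, 0.19], compatible with Λ* = K·Λ_c ∈ [0.015, 0.3]); fixed already: window [1/8,1/5], Cooper
margin 2, gap ratio 10. Physical stiffness ratio handed to R: ρ_s/Λ₀ ~ 10³–10⁴ (kStar can be
generous). Constructive radii in print: none explicit for d = 2 Fermi surfaces
(GiulianiMastropietroRychkov2021 §8.1.5: "We have not attempted to evaluate ε₀(γ) explicitly").
SOURCES. CAP/a-posteriori format: Lanford1982Feigenbaum, KochWittwer1994, FiguerasHaroLuque2016 (Thm
2.5). Fermionic RG with constants / counterterm frame: Salmhofer1998 (pp. 4, 26 read),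
FeldmanSalmhoferTrubowitz1996, BenfattoGiulianiMastropietro2003, Salmhofer1999, PedraSalmhofer2008,
DisertoriRivasseau2000, FeldmanKnorrerTrubowitz2004, BenfattoGiulianiMastropietro2006,
GiulianiMastropietroRychkov2021, GiulianiEtAl2025, Kashima2021ImaginaryFieldBCS; flows into the
broken phase: SalmhoferEtAl2004, GerschHonerkampMetzner2008, EberleinMetzner2014; Bose side:
BalabanEtAl2010, BFKT2017. Duality lever: FrohlichSpencerCMP1982 (cite-only, acq-00340; statement
via DarioWu2020 Prop 1.1), DarioWu2020 (held: paper:arxiv-2002.02946), KennedyKing1986 (acq-03770),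
Guth1980, Balaban1995, Balaban1996, Balaban1998 (acq-03929), BalabanOcarroll1999,
GarbanSepulveda2023 (held), GiulianiOtt2025 (held: paper:arxiv-2302.07299), BricmontEtAl1981,
WallinEtAl1994, Ueltschi2013 (held), BenassiLeesUeltschi2016 (held; Ginibre inequalities for S = ½,
1 — fixed-sign tools that do NOT give U(1)-symmetric monotonicity, recorded as
considered-and-not-used), CorreggiGiulianiSeiringer2015 (large-S spin-wave technology). Order / RP
side: KLS1988PRL, DLS1978, NevesPerez1986, LSSY2005 (§1.2 p. 8, §11.1 p. 117 held), Tasaki2019Tower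
§3.2, KomaTasaki1994, Knabe1988, GossetMozgunov2016. Phase diagram: DengEtAl2015 (held),
RaghuKivelsonScalapino2010, ArovasBergKivelsonRaghu2022, HalbothMetzner2000, HonerkampEtAl2001.
DEFINITION REQUESTS. (D1, DONE p70233) hubbardScaleReport — landed as BARE-frame v1 (its own
UPSTREAM caveat; the FRAME amendment (vii), FRAME_NOTE.md, arrived as v1 closed); kept for the
record, superseded for this route by (D1″, filed rev 14, REPAIR_13960.md §5) hubbardScaleReportCT U
μ D h : HubbardScaleData.Report D.numPatches — the SAME components rebuilt on
hubbardEffectiveActionCT with the frame K ∃-bound inside the realised set and shell / patches /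
nodes on {e_K = 0}, v1 API + hubbardScaleReport_subset_CT; it types [3]'s conclusion and [5]'s
hypothesis. (D1′a, DONE p70757) hubbardEffectiveActionCT L M β U μ h K Λ (TrigPolyC4v frames, e_K in
covariance AND cutoff, counterterm vertex in the interaction slot, K = 0 = the bare objects). (D1′b
v1, DONE p71321/p71475) SymmetricRegimeFunctionals / SymmetricRegimeCertificate: the certificate
functionals in ONE normalisation (sup norms of vertex functions 𝒱_m = m!ε^{1−m}F_m with bare 𝒱₄ = U,
self-energy / mismatch / field strength at ±ω₀, remainderWeightNorm, Cooper operator in BCS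
normalisation with CooperDominance margin 2, Stoner products with the scale-Λ bubble, ShellGeometry)
— KEPT as the functional layer; its predicate still has Θ = (η₁, c₀, w), the unit-radius ρ and the
enclosure inside the L/β/M block (the rev-14 amendment REPAIR_13960.md §4 arrived as it closed).
(D1′b-v2, filed 2026-08-16 by the stmt-13959 repair seat: defn-symmetricRegimeCertificateR,
wanted_by stmt-14026; elaborating prototype Sketch.lean rc 0 + REPAIR_13959.md as evidence there and
on 14026/14042) symmetricRegimeCertificateR U μ π Θ K Λ L₀ with SymmetricRegimeDataR = v1 π + (r,
E₃, h_r, c₁), SymmetricTolerance Θ = (c₀, w) ONLY, (0b′) pointwise with slope allowance c₁, (i′a)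
‖𝒱₄‖_∞ ≤ E₁ and (i′b) ρ AT FIELD RADIUS h_r := remainderWeightNorm (h_r²Λ) ≤ E₃ (no new functional),
ENCLOSURE [a,b] bound OUTSIDE the block, and the literal capRgCornerData = π₀ (ONE named constant
for producer and consumer); junk tests J1 false at U = 0, J2 no floor under c₀ / w, J3 M-stability
(v1 sup norms), J4 π₀ elaborates; LANDED p72167 (2026-08-16T00:37Z) exactly as specified — and
therefore with the untruncated (i′b), which rattack-14026 M1″ (note 13 s earlier) shows is never
instantiated at U > 0: v2 stays as the record layer v3 extends. (D1′b-v3, filed rev 18 by the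
stmt-14026 repair seat: defn-symmetricRegimeCertificateT, wanted_by stmt-14026; self-contained spec
in the item, prototype Sketch.lean rc 0 + REPAIR_14026.md as evidence there and on 14026)
SymmetricRegimeDataT = v2 π + remainderDegree, remainderWeightNormUpTo (truncated v1 summands, ≤ the
v1 sum), SymmetricCertifiedAtT / HoldsT / symmetricRegimeCertificateT U μ π Θ K Λ L₀ = v2 verbatim
except (i′b) := remainderWeightNormUpTo L M m_max β (h_r²Λ) G ≤ E₃, literal capRgCornerDataT =
{capRgCornerData with remainderDegree := 10}, SymmetricCertifiedAtT.of_R (v2 ⇒ v3), junk tests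
J1/J3/J4; it types [2] (signature = Sketch Item2T, set at definition-landed) and [3]'s hypothesis
(rev 20: [3]'s signature = REPAIR_14042.md §4 = Item3T of the 14042 seat's Sketch.lean, conclusion +
`0 < D.numPatches`; NO further definition is requested for [3] — its consumer norm ctActionNormBelow
and obligation TailBallAtScale are Theses-side, inline over the tree); D1″ hubbardScaleReportCT
LANDED 2026-08-16T00:26Z, so [3] and [5] are typable now (shapes Item3T / Item5, glue
fixedPoint_of_items PROVED). (D2, foreseen, not filed) the anisotropic classical Villain measure on
(ℤ/Lℤ)²×(ℤ/Mℤ) for the first lemma of R's phase-sector engine, formerly [4] (the tree's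
villainKernel of U1VillainMasslessPhotonD4 is the d = 4 gauge version). Landed earlier:
HubbardScaleData, hubbardEffectiveAction (both done).
CONE FACTS (route-repair 2026-08-16, cone gen 1, planner 93175676). The dispatcher's MODULE-level
import-cone guardrail lists 4 unproved named facts under this route —
Literature.MathematicalPhysics.QuantumLattice.bgm_two_point_limit (HubbardFermiLiquid.lean),
Literature.NumberTheory.GaloisRepresentations.GaloisRep.natCast_localArtinConductor
(ArtinConductor.lean), Literature.MathematicalPhysics.QuantumFieldTheory.CaoParkSheffieldProblem
(ConstructiveQFTWave0.lean, @[conjecture] [status: open]) and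
Literature.Probability.LatticeModels.bodineau_translationInvariant (GibbsStates.lean). NONE is
load-bearing: the gate's constant-level cone (#h21_route_deps) is 192 project constants with 0
unproved; no item, glue or `closes` names any of them; needs-fact: none. All four ride in on ONE
route import, HubbardScaleReportCT (needed: AposterioriOrderCriterionR is typed over
hubbardScaleReportCT, and [2]/[3] are typed over SymmetricRegimeCertificateT /
hubbardEffectiveActionCT, same chain), through four Literature-internal over-broad edges: (E1)
GrassmannEffectiveAction imports NumberTheory…WeilDeligneRepLadicProofs only for the
exp/log-of-nilpotents lemmas Ladic.exp_logSum / logSum_exp_sub_one / logSum_pow_eq_zero (drags 28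
Galois modules); (E2) GrassmannIntegral and GaugeGroups import ConstructiveQFTWave0 for GaugeConfig
/ Site.shift, whose last decl is the open problem CaoParkSheffieldProblem (no code references it; it
sits in 53 route cones fleet-wide); (E3) HubbardFreePropagator imports HubbardFermiLiquid only for
the def hubbardThermalTwoPoint in its two final theorems
hubbardThermalTwoPoint_zero_interaction_eq_sum{,_latticeMomentum}; (E4) LatticeGreenRiemannSum
imports SharpnessProofs only for the box/sphere combinatorics Site.supNorm / sphere /
card_sphere_succ_le (drags GibbsStates + 10 Ising modules). DWaveSource and XYOrder cones are clean;
HubbardScaleData alone is clean. Hence 0 imports droppable, 0 cruxes restated, route kept open.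
Unblocking is operator-side, not a planner action: one import-hygiene commit moving those four
pieces to same-directory leaf/base modules (FQNs unchanged; recipe E1–E4 in the repair seat's
NOTES.md; cone 98 → 59 modules, 0 unproved), or letting the guardrail use the gate's constant-level
cone (`route show`: staffable YES) and skip [status: open] conjecture decls — the same finding the
YangMills/ConvexGribovBody and Hubbard/ChernVortexResponse repair planners recorded on 2026-08-15.

Novelty: Searches RUN this rev (2026-08-15, promote pass): `lit search` (searchd rc 75 ×1; crossref 'Balaban
low temperature expansion classical N-vector' → Balaban1995/1996/1998, BalabanOcarroll1999,
GiulianiOtt2025; zbmath same; arxiv → GiulianiOtt2025 = arXiv:2302.07299, read pp. 1–6; OpenAlex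
429), `lit galaxy search "symmetry restoration in abelian gauge theories" --star all` (8 rows:
DarioWu2020 = arXiv:2002.02946 'Massless phases for the Villain model in d ≥ 3', read pp. 1–12 + Ch.
1 §4; CorreggiGiulianiSeiringer2015; Forsström–Lenells–Viklund 2020; Montvay–Münster), `lit read`
DarioWu2020 (held now), GarbanSepulveda2023 (held), BenassiLeesUeltschi2016 (held; Thm 1 / Cor 2
read), DengEtAl2015 p. 3 (held), FS82 / KennedyKing1986 / Balaban1995 paywalled (acq-00340
cite-only, acq-03770, acq-03929); earlier passes: the card's log, two route reviews and the novelty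
audit of 2026-08-15 (crossref-only, searchd down), `lit frontier HubbardSuperconductivity --since
2020` (30 rows, none on constructive RG / order criteria). NEAREST PRIOR ART FOUND. (1) CAP /
a-posteriori format: Lanford1982Feigenbaum, KochWittwer1994, FiguerasHaroLuque2016 — no fermions.
(2) Explicit-constant fermionic RG: GiulianiMastropietroRychkov2021, GiulianiEtAl2025 — no Fermi
surface, no SSB. (3) Finite-L multiscale SC phase: Kashima2021ImaginaryFieldBCS — reduced BCS
interaction. (4) Rigorous fermionic RG above the pairing scale: Salmhofer1998, PedraSalmhofer2008,
DisertoriRivasseau2000, FeldmanKnorrerTrubowitz20  [refs: 2302.07299, 2002.02946, Balaban1995, BalabanOcarroll1999, GiulianiOtt2025, DarioWu2020, CorreggiGiulianiSeiringer2015, GarbanSepulveda2023, BenassiLeesUeltschi2016, DengEtAl2015, KennedyKing1986, KochWittwer1994, FiguerasHaroLuque2016, GiulianiMastropietroRychkov2021, GiulianiEtAl2025, Salmhofer1998, PedraSalmhofer2008, DisertoriRivasseau2000, FeldmanKnorrerTrubowitz2004, BenfattoGiulianiMastropie]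

Barriers (technique_class: constructive-RG; certified-numerics; SSB-field; duality): - technique_class: constructive-RG; certified-numerics; SSB-field; duality
- Literature.Barriers.HubbardSuperconductivity.WeakCouplingCeiling: APPLIES head-on (constructive-RG
/ determinant bounds) and is MET, not evaded asymptotically — |λ log(βε₀)| < const (Salmhofer1999
(4.175)) becomes finitely many certified inequalities at ONE fixed (U,δ) over ≈ 18–22 scales at the
corner (3,1/5), h = 0, down to Λ* = KΛ_c only (CapRgSymmetricCertificate); below Λ* the B1g channel
is HS-decoupled and the phase is a boson (SeededBrokenRegimeBoseFermi); no source prints a theorem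
that a reorganised expansion cannot cross the pairing scale; the bet is on constants (kill (a)).
- Literature.Barriers.HubbardSuperconductivity.WeakCouplingCeilingNarrow: APPLIES to the CAP half
and is BUDGETED — CapRgSymmetricCertificate is sign-blind in the B1g channel, so conjunct (1)
confines it to where the attractive ladder is summable: it STOPS at Λ* = K·Λ_c with |λ_{B1g}(Λ*)| ≤
ε₁, K = e^{1/ε₁} above the pole of conjunct (3) (for ε₁ = 0.2: K ≈ 150, ≈ 7 scales above Λ_c); the
half below Λ* is the entry's NOT-covered case (b), an expansion around the HS / Koma–Tasaki-seeded
symmetry-broken reference closed by the saddle-point equation, where the pole is the physics; its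
scope_caveat (d) (no such expansion for a short-range d = 2 lattice fermion model in print) is crux
[3]'s why-might-fail, a gap, not a theorem against the line.
- Literature.Barriers.HubbardSuperconductivity.PerturbativeInvisibilityOfPairing:

Novelty grade: new-combination — ROUTE REVIEW #2 (refuter 63bb7716, 2026-08-15; ac84c4a2's per-item briefings stay on 1313–1316). VERDICT: PASS STRUCTURALLY; rank-3 crux 1314 KlsOrderOpenness SUSPECT-FALSE AS TYPED (evidence KLS_DM_counterexample.md + block note on the item). Typed 4/4 elaborate (W2.lean rc0); Assembly pure logic o (refuter refuter-rreview-route-PneNP-PositionalGa-63bb7716-0, 2026-08-15T12:13:09Z; prior: KLS1988PRL, doi:10.1007/bf01020284, doi:10.1038/srep10050, LSSY2005, KochWittwer1994, FiguerasHaroLuque2016, GiulianiMastropietroRychkov2021, Knabe1988, KomaTasaki1994)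

History (route lifecycle, newest last):
- 2026-08-15T22:49:41Z · rev 9: dropped stmt-HubbardSuperconductivity-10206, stmt-HubbardSuperconductivity-1375, stmt-HubbardSuperconductivity-1381 — promote-to-A (2/3): DROP the superseded wants — KlsOrderOpennessR (stmt-10206: all-spin form contains the LSSY hard-core-boson open problem and is not load-bear (planner-promote-HubbardSuperconductivity-Apost-93175676-0)
- 2026-08-15T23:31:19Z · rev 13: dropped stmt-HubbardSuperconductivity-13882, stmt-HubbardSuperconductivity-13883 — route-repair (2/2): DROP the wants of CapRgSymmetricCertificate (stmt-13882, refuted-MISSTATED on paper by refuter rattack-13882: the crux was anchored to hubba (planner-rrefute-HubbardSuperconductivity-Apost-621121eb-0)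
- 2026-08-16T00:09:58Z · rev 15: dropped stmt-HubbardSuperconductivity-14041, stmt-HubbardSuperconductivity-13959, stmt-HubbardSuperconductivity-13960 — route-repair after refuter rattack-13960's refuted-MISSTATED verdict on stmt-13960 (ATTACK.md/Probe13960.lean; M1: the consumer-chosen 'accuracy' η₁ bounded the (planner-rrefute-HubbardSuperconductivity-Apost-3449f5e8-0)
- 2026-08-16T01:38:20Z · rev 24: restated CapRgSymmetricCertificatePinned (stmt-HubbardSuperconductivity-14026) — route-repair (seat 24c32d83), the TYPED half: D1′b-v3 SymmetricRegimeCertificateT LANDED (p73474, b1b50a35c3b0, exactly as specced) ⇒ [2] CapRgSymmetricCertific (planner-rrefute-HubbardSuperconductivity-Apost-24c32d83-0)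
- 2026-08-16T01:40:20Z · rev 26: restated SeededBrokenRegimeBoseFermiPinned (stmt-HubbardSuperconductivity-14042) — route-repair (seat c932044b, typed half): [3] SeededBrokenRegimeBoseFermiPinned RESTATED AS A TYPED ITEM over the landed D1′b-v3 symmetricRegimeCertificateT / c (planner-rrefute-HubbardSuperconductivity-Apost-c932044b-0)
- 2026-08-16T04:06:07Z · AUTO-CRUX (backfill): FixedPointDWaveOrder — hypotheses of the deciding theorem that nothing in the route derives are cruxes (operator:999:1085951)
- 2026-08-16T06:34:00Z · rev 33: dropped XYOrderOpennessLargeSpin — route-repair (unused-crux; views3 cone of `closes`; unit rrepair-HubbardSuperconductivity-Apost-a1761a32): DROP the rank-4 crux XYOrderOpennessLargeSpin (stmt-1 (planner-rrepair-HubbardSuperconductivity-Apost-a1761a32-0)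
- 2026-08-24T04:19:53Z · DORMANT — reconciler: no traction for 6.5 d (last activity item-evidence-added at 2026-08-17T15:01:23Z); parked, not closed — `ledger route dormant route-HubbardSupercond (operator:999:736694)

sub-problem: HubbardSuperconductivity · status: dormant · opened planner-plancard-HubbardSuperconductivity-Hub-c504a47b-0 2026-08-15T10:54:33Z · rev 34 · ledger route-HubbardSuperconductivity-AposterioriCapRg
GENERATED by the gate from the ledger (D-0016/17). Provers cite these decls: `theorem foo : Summit.HubbardSuperconductivity.HubbardSuperconductivity.Theses.AposterioriCapRg.<Decl> := …` in Summits/HubbardSuperconductivity/HubbardSuperconductivity/Theorems/<Name>.lean.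
-/

namespace Summit.HubbardSuperconductivity.HubbardSuperconductivity.Theses.AposterioriCapRg

open scoped BigOperators Topology Manifold Classical MeasureTheory ProbabilityTheory Matrix InnerProductSpace ComplexConjugate ContinuousMap
open Filter Set Function TopologicalSpace MeasureTheory

attribute [summit_statement] _root_.HubbardSuperconductivity

open Literature.Hubbard

/-- item stmt-HubbardSuperconductivity-1313 · target (kind.auto-crux: conjecture-grade) · rank 0 · open · by planner
why it might fail: No certifiable point may exist with present constructive constants; an incommensurate SDW (δ≈0.2, U=3), d_xy/p-wave competition (n<0.6) or phase separation (no μ with density → 1−δ) could empty the box; at δ=0.3 the pairing scale may be <1e-4 t.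
sources: DengEtAl2015, RaghuKivelsonScalapino2010, ArovasBergKivelsonRaghu2022, HalbothMetzner2000, KomaTasaki1994, Literature.Barriers.HubbardSuperconductivity.PureModelStripeCompetition
[target] X (it suffices to show): at some FIXED moderate coupling and doping in the box U ∈ [2,3], δ
∈ [1/5, 7/20] (card's proposal (U,δ) = (5/2, 3/10); inside the diagMC / weak-coupling 'BCS
d_{x²−y²}' region U ≤ 4, n > 0.6 of DengEtAl2015 and RaghuKivelsonScalapino2010 Fig. 2, far from the
stripe box (8, 1/8) and from van Hove filling) there is μ with grand-canonical tracial ground-state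
density → 1−δ (along L+1, all L) and Koma–Tasaki d-wave order `HasDWaveOrder U μ` (DWaveSource.lean:
source h → 0⁺ AFTER L → ∞). Delivered by CapRgScaleData + AposterioriOrderCriterion: no asymptotics
in U — the small resource is the scale count log₂(W/Λ₀) ≈ 10–15, the constructor picks the point of
the box. X → Statement via SsbToEvenTorusLro + Assembly (pure logic). -/
@[route_item "route-HubbardSuperconductivity-AposterioriCapRg"]
def FixedPointDWaveOrder : Prop :=
  ∃ U ∈ Set.Icc (2:ℝ) 3, ∃ δ ∈ Set.Icc (1/5:ℝ) (7/20), ∃ μ : ℝ, Filter.Tendsto (fun L : ℕ => ((Literature.MathematicalPhysics.QuantumLattice.hubbardTorusWith 2 (L + 1) 1 U μ).groundStateFunctional Literature.MathematicalPhysics.QuantumLattice.totalNumber).re / ((L + 1 : ℕ) : ℝ) ^ 2) Filter.atTop (nhds (1 - δ)) ∧ Literature.MathematicalPhysics.QuantumLattice.HasDWaveOrder U μ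

-- earlier CapRgSymmetricCertificatePinned (stmt-HubbardSuperconductivity-14026, replaced 2026-08-16T01:38:20Z -> stmt-HubbardSuperconductivity-14045): retired by None — [crux] CapRgSymmetricCertificatePinned — THE FINITE CAP STEP (h = 0, symmetric regime, countertermed frame) WITH PINNED INTERFACE NUMERALS; supersedes CapRgSymmetricCertificateCT (stmt-13959: same root as the refuted-misstated consum
/-- item stmt-HubbardSuperconductivity-14045 · crux · rank 2 · open · by planner
why it might fail: No explicit 2-d sector constants may certify M→∞ stability of any clause at U=3 (printed radii |U|≲1e-2); (i′b)-v3 bounds 𝒱₆–𝒱₁₀ only — no tail for [3], a ball clause in [3]'s norm is unsized; corner Stoner RPA 1.22/screened≈0.85 vs margin 3/4; λ_d⁰≈0.044 at kill (a)'s edge; Λ*≲0.19.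
sources: Salmhofer1998, FeldmanSalmhoferTrubowitz1996, BenfattoGiulianiMastropietro2006, BenfattoGiulianiMastropietro2003, PedraSalmhofer2008, DisertoriRivasseau2000
[crux] CapRgSymmetricCertificatePinned — THE FINITE CAP STEP (h = 0, symmetric regime, countertermed
frame) WITH PINNED INTERFACE NUMERALS, clause (i′b) DEGREE-TRUNCATED (route rev 18–19, repair C‴
after refuter rattack-14026's refuted-MISSTATED verdict M1″ on the rev-14/16 reading: in v1's
normalisation 𝒱_m = m!·ε^{1−m}·F_m the full sup-norm degree sum Σ_{m∉{0,2,4}}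
h_r^{m−4}Λ^{(m−4)/2}‖𝒱_m‖_∞ is factorial in the degree at EVERY field radius — n! coherent spectator
orderings of zero-transfer forward scattering, exact Wick count 2, 6, 24 — so v2
symmetricRegimeCertificateR is never instantiated at U > 0; evidence ATTACK_14026.md,
REPAIR_14026.md). STATEMENT (typed over D1′b-v3 symmetricRegimeCertificateT): ∃ U ∈ [2,3], δ ∈
[1/5,7/20], μ with GC tracial ground-state density → 1−δ (as in FixedPointDWaveOrder; proposal
corner (3,1/5)) such that FOR ALL tolerances Θ = (c₀, w) > 0 there are a frame K : TrigPolyC4v, a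
stopping scale Λ* and L₀ with symmetricRegimeCertificateT U μ π₀ Θ K Λ* L₀, π₀ = capRgCornerDataT
the ONE LITERAL record (t = 1, t′ = 0): frame decay r = 4 with coeffNorm ≤ 10; E₁ = 4; E₃ = 32 at
field radius h_r = 1/4 on degrees ≤ m_max = 10; c₁ = 1/2; σ = 1/4; ζ = 1/2; |∇ -/
@[route_item "route-HubbardSuperconductivity-AposterioriCapRg", crux]
def CapRgSymmetricCertificatePinned : Prop :=
  ∃ U ∈ Set.Icc (2:ℝ) 3, ∃ δ ∈ Set.Icc (1/5:ℝ) (7/20), ∃ μ : ℝ, Filter.Tendsto (fun L : ℕ => ((Literature.MathematicalPhysics.QuantumLattice.hubbardTorusWith 2 (L + 1) 1 U μ).groundStateFunctional Literature.MathematicalPhysics.QuantumLattice.totalNumber).re / ((L + 1 : ℕ) : ℝ) ^ 2) Filter.atTop (nhds (1 - δ)) ∧ ∀ Θ : Literature.MathematicalPhysics.QuantumLattice.SymmetricTolerance, ∃ (K : Literature.MathematicalPhysics.QuantumLattice.TrigPolyC4v) (Λ : ℝ) (L₀ : ℕ), Literature.MathematicalPhysics.QuantumLattice.symmetricRegimeCertificateT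 U μ Literature.MathematicalPhysics.QuantumLattice.capRgCornerDataT Θ K Λ L₀

-- earlier SeededBrokenRegimeBoseFermiPinned (stmt-HubbardSuperconductivity-14042, replaced 2026-08-16T01:40:20Z -> stmt-HubbardSuperconductivity-14047): retired by None — [crux] SeededBrokenRegimeBoseFermiPinned — THE h-UNIFORM BOSE–FERMI THEOREM for the seeded broken regime AT THE PINNED INTERFACE; repaired SeededBrokenRegimeBoseFermiCT (stmt-13960, refuted-MISSTATED on paper by refuter rattack-139
/-- item stmt-HubbardSuperconductivity-14047 · crux · rank 3 · open · by planner
why it might fail: No constructive control of continuous SSB with a Goldstone mode exists for any short-range Fermi-surface system (Kashima2021: reduced BCS; BFKT2017 unfinished); v3 hands finite low-degree data, so the tail ball at Λ* must be proved at U = 3, no printed radius; E₁, E₃ no radius; nodal cones × soft θ.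
sources: SalmhoferEtAl2004, FeldmanKnorrerTrubowitz2004, BenfattoGiulianiMastropietro2006, Kashima2021ImaginaryFieldBCS, EberleinMetzner2014, BalabanEtAl2010
[crux] SeededBrokenRegimeBoseFermiPinned — THE h-UNIFORM BOSE–FERMI THEOREM for the seeded broken
regime AT THE PINNED v3 INTERFACE (restated 2026-08-16 by the route-repair pass labelled 'rev 20' in
the route header — file revs 21–23, seat c932044b — after refuter rattack-14042-g2's
refuted-MISSTATED verdict: typed over v2 the hypothesis symmetricRegimeCertificateR …
capRgCornerData … is never instantiated — rattack-14026 M1″, factorial floor of the untruncated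
clause (i′b) — so the item held for ANY conclusion; evidence REPAIR_14042.md + Sketch.lean on this
item). STATEMENT: FOR ALL rational thresholds kStar, etaStar > 0 THERE EXISTS a tolerance Θ = (c₀,
w) : SymmetricTolerance such that FOR ALL U ∈ [2,3], δ ∈ [1/5,7/20], μ with grand-canonical tracial
ground-state density → 1−δ (the density clause of FixedPointDWaveOrder, byte-identical) and ALL K :
TrigPolyC4v, Λ*, L₀: IF symmetricRegimeCertificateT U μ capRgCornerDataT Θ K Λ* L₀ holds (D1′b-v3
defn-symmetricRegimeCertificateT, the SAME predicate and the SAME literal π₀ᵀ = {capRgCornerData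
with remainderDegree := 10} that [2] CapRgSymmetricCertificatePinned produces: h = 0 certificate of
hubbardEffectiveActionCT L M β U μ 0 K Λ* -/
@[route_item "route-HubbardSuperconductivity-AposterioriCapRg", crux]
def SeededBrokenRegimeBoseFermiPinned : Prop :=
  ∀ kStar etaStar : ℚ, 0 < kStar → 0 < etaStar → ∃ Θ : Literature.MathematicalPhysics.QuantumLattice.SymmetricTolerance, ∀ U ∈ Set.Icc (2:ℝ) 3, ∀ δ ∈ Set.Icc (1/5:ℝ) (7/20), ∀ μ : ℝ, Filter.Tendsto (fun L : ℕ => ((Literature.MathematicalPhysics.QuantumLattice.hubbardTorusWith 2 (L + 1) 1 U μ).groundStateFunctional Literature.MathematicalPhysics.QuantumLattice.totalNumber).re / ((L + 1 : ℕ) : ℝ) ^ 2) Filter.atTop (nhds (1 - δ)) → ∀ (K : Literature.MathematicalPhysics.QuantumLattice.TrigPolyC4v) (Λ : ℝ) (L₀ : ℕ), Literature.MathematicalPhysics.QuantumLattice.symmetricRegimeCertificateT U μ Literature.MathematicalPhysics.QuantumLattice.capRgCornerDataT Θ K Λ L₀ → ∃ h₀ : ℝ, 0 < h₀ ∧ ∃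 D : Literature.MathematicalPhysics.QuantumLattice.HubbardScaleData, D.MeetsThresholds kStar etaStar ∧ 0 < D.numPatches ∧ 0 < D.meanFieldDensity.fst ∧ ∀ h ∈ Set.Ioc (0:ℝ) h₀, ∃ L₀' : ℕ, D.IsCertifiedEnclosure (Literature.MathematicalPhysics.QuantumLattice.hubbardScaleReportCT U μ D h) L₀'

/-- item stmt-HubbardSuperconductivity-1315 · crux · rank 5 · open · by planner
why it might fail: Without uniqueness of the (N_L,0)-sector ground state a degenerate ground space may contain states with LRO density < m² (tower mixing, LROForcesLowLyingStates); GC density → 1−δ can coexist with a canonical density jump (phase separation); KomaTasaki1994 prove only LRO ⇒ SSB.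
sources: KomaTasaki1994, Tasaki2019Tower, Tasaki1998, WreszinskiZagrebnov2016, Literature.Barriers.HubbardSuperconductivity.LROForcesLowLyingStates
[crux] EVERY-GROUND-STATE TRANSFER ON EVEN TORI (the card's W6 import; even-L tailoring of
WeakCouplingBCS's WcbcsSsbToTorusLRO = stmt-HubbardSuperconductivity-0157, whose hypothesis runs
over ALL L: a proof of 0157 gives this item by modifying ψ at odd L to any sector ground state, a
refutation of this item refutes 0157). For U > 0, δ ∈ (0,1) and μ with grand-canonical tracial
ground-state density → 1−δ, Koma–Tasaki d-wave order `HasDWaveOrder U μ` (source h → 0⁺ AFTER L → ∞,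
DWaveSource.lean) implies that EVERY sequence of normalised (N_L, S^z = 0)-sector ground states of
the source-free canonical model hubbardTorus 2 L 1 U with N_L = 2⌊(1−δ)L²/2⌋ — exactly the
Statement's hypothesis, which constrains even L only — has d_{x²−y²} pair-field LRO in the
Statement's literal sense (HasLongRangeOrder of torusPullback (pairFieldCorr dWaveFormFactor ψ) (2k)
over halfOpenBox 2 (2k)). Only the converse (LRO ⇒ SSB/low-lying states) is a theorem
(KomaTasaki1994 Thm 2.2 = tree LROForcesLowLyingStates_holds; Tasaki2019Tower Thm 3.5). Lines of
proof: mesoscopic-source selection at L⁻⁴ ≪ h_L ≪ L⁻³ plus 1/L sector gaps (card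
mesoscopic-source-selection), or generic-U Schur arguments (card generic -/
@[route_item "route-HubbardSuperconductivity-AposterioriCapRg", crux]
def SsbToEvenTorusLro : Prop :=
  ∀ (U δ μ : ℝ), 0 < U → δ ∈ Set.Ioo (0:ℝ) 1 → Filter.Tendsto (fun L : ℕ => ((Literature.MathematicalPhysics.QuantumLattice.hubbardTorusWith 2 (L + 1) 1 U μ).groundStateFunctional Literature.MathematicalPhysics.QuantumLattice.totalNumber).re / ((L + 1 : ℕ) : ℝ) ^ 2) Filter.atTop (nhds (1 - δ)) → Literature.MathematicalPhysics.QuantumLattice.HasDWaveOrder U μ → ∀ (N : ℕ → ℕ) (ψ : ∀ L, Literature.MathematicalPhysics.QuantumLattice.Fock (Literature.MathematicalPhysics.QuantumLattice.Orb (Literature.MathematicalPhysics.QuantumLattice.FermionTorus 2 L))), (∀ L, Even L → N L = 2 * ⌊(1 - δ) * (L : ℝ) ^ 2 / 2⌋₊ ∧ star (ψ L) ⬝ᵥ ψ L = 1 ∧ Literature.MathematicalPhysics.QuantumLattice.IsGroundStateInSector (Literature.MathematicalPhysics.QuantumLattice.hubbardTorus 2 L 1 U) (N L) 0 (ψ L))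 → Literature.Probability.LatticeModels.HasLongRangeOrder (fun k => Literature.Probability.LatticeModels.halfOpenBox 2 (2 * k)) (fun k => Literature.MathematicalPhysics.QuantumLattice.torusPullback (Literature.MathematicalPhysics.QuantumLattice.pairFieldCorr Literature.MathematicalPhysics.QuantumLattice.dWaveFormFactor ψ) (2 * k))

/-- item stmt-HubbardSuperconductivity-13884 · crux · rank 5 · open · by planner
why it might fail: No a-posteriori criterion for GAPLESS U(1) order exists in print (Knabe1988/GossetMozgunov2016 are gap criteria); the nodal Dirac–Goldstone IR is non-Gaussian; explicit constants may force kStar beyond what SeededBrokenRegimeBoseFermi certifies (physical ρ_s/Λ₀ ~ 1e3).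
sources: KLS1988PRL, FrohlichSpencerCMP1982, DarioWu2020, KennedyKing1986, BalabanOcarroll1999, Knabe1988
[crux] AposterioriOrderCriterionR — THE A-POSTERIORI (KNABE-TYPE) THEOREM R FOR T = 0 U(1) ORDER,
Hubbard-typed; repaired AposterioriOrderCriterion (stmt-HubbardSuperconductivity-1381,
refuted-MISSTATED on paper by refuter rattack-1381, ATTACK.md: F1 quantifier ∀h∃L₀, F2 parity, F3
named thresholds + m₀ > 0 + h₀ > 0, F4 one normal-form report). STATEMENT (typed the day
hubbardScaleReport lands, definition request D1): ∃ kStar etaStar : ℚ, 0 < kStar ∧ 0 < etaStar ∧ ∀ U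
μ h₀ (D : HubbardScaleData), 0 < h₀ → (∀ h ∈ Set.Ioc 0 h₀, ∃ L₀, D.IsCertifiedEnclosure
(hubbardScaleReport U μ D h) L₀) → D.MeetsThresholds kStar etaStar → (D.meanFieldDensity.fst : ℝ)/2
≤ dWaveOrderParameter U μ (hence HasDWaveOrder U μ whenever m₀.fst > 0, hasDWaveOrder_iff). The
thresholds are ∃-bound HERE and met ∀-uniformly by SeededBrokenRegimeBoseFermi, so the glue
CapRgSymmetricCertificate → SeededBrokenRegimeBoseFermi → AposterioriOrderCriterionR →
FixedPointDWaveOrder is pure logic. The report hubbardScaleReport U μ D h : Report D.numPatches is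
the ONE normal-form predicate 'the scale-D.scale effective action hubbardEffectiveAction of
dWaveSourceTorus L U μ h has the form S_phase[θ; ρ_s, κ] + S_qp + S_mix + -/
@[route_item "route-HubbardSuperconductivity-AposterioriCapRg", crux]
def AposterioriOrderCriterionR : Prop :=
  ∃ kStar etaStar : ℚ, 0 < kStar ∧ 0 < etaStar ∧ ∀ (U μ h₀ : ℝ) (D : Literature.MathematicalPhysics.QuantumLattice.HubbardScaleData), 0 < h₀ → (∀ h ∈ Set.Ioc (0:ℝ) h₀, ∃ L₀ : ℕ, D.IsCertifiedEnclosure (Literature.MathematicalPhysics.QuantumLattice.hubbardScaleReportCT U μ D h) L₀) → D.MeetsThresholds kStar etaStar → ((D.meanFieldDensity.fst : ℚ) : ℝ) / 2 ≤ Literature.MathematicalPhysics.QuantumLattice.dWaveOrderParameter U μ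

/-- item stmt-HubbardSuperconductivity-14250 · support · rank 9 · closed · proved by Summit.HubbardSuperconductivity.HubbardSuperconductivity.Theorems.aposterioriCapRg_fixedPointOfCertifiedChain_proof (prover) · by planner
sources: KomaTasaki1994, Literature.MathematicalPhysics.QuantumLattice.hasDWaveOrder_iff
[support] GLUE INTO THE TARGET (route-choice repair 2026-08-16 after the operator hold
`target-unreachable` on FixedPointDWaveOrder: no item concluded the target, so cruxes [2],[3],[5]
were formally dangling). The certified chain delivers X by PURE LOGIC: R =
AposterioriOrderCriterionR supplies its named thresholds (kStar, etaStar); [3]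
SeededBrokenRegimeBoseFermiPinned at those thresholds supplies the accuracy Θ = (c₀, w); [2]
CapRgSymmetricCertificatePinned supplies (U, δ, μ), the density clause and, at Θ, the certificate
(K, Λ*, L₀) for symmetricRegimeCertificateT at the ONE literal record π₀ᵀ = capRgCornerDataT shared
by producer and consumer; [3] returns h₀ > 0 and D : HubbardScaleData with D.MeetsThresholds kStar
etaStar, 0 < D.meanFieldDensity.fst and the certified enclosure of hubbardScaleReportCT U μ D h for
every h ∈ (0, h₀]; R returns m₀/2 ≤ dWaveOrderParameter U μ, hence HasDWaveOrder U μ by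
hasDWaveOrder_iff (Iff.rfl: HasDWaveOrder U μ ↔ 0 < dWaveOrderParameter U μ) since m₀ > 0.
Producer-∀ / consumer-∃ on the accuracy, one literal record on both sides: no unglued ∃, no floor.
PROVED in the planner's Sketch.lean (theorem fixedPointOfCertifiedChain_holds, 12 tactic line -/
@[route_item "route-HubbardSuperconductivity-AposterioriCapRg"]
def FixedPointOfCertifiedChain : Prop :=
  CapRgSymmetricCertificatePinned → SeededBrokenRegimeBoseFermiPinned → AposterioriOrderCriterionR → FixedPointDWaveOrder

/-- `FixedPointOfCertifiedChain` holds: proved by `Summit.HubbardSuperconductivity.HubbardSuperconductivity.Theorems.aposterioriCapRg_fixedPointOfCertifiedChain_proof`. -/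
theorem FixedPointOfCertifiedChain_holds : FixedPointOfCertifiedChain := _root_.Summit.HubbardSuperconductivity.HubbardSuperconductivity.Theorems.aposterioriCapRg_fixedPointOfCertifiedChain_proof

/-- item stmt-HubbardSuperconductivity-1316 · assembly · rank 1 · closed · proved by Summit.HubbardSuperconductivity.HubbardSuperconductivity.Theorems.aposterioriCapRg_assembly_proof (prover) · by planner
sources: Scalapino1995
[assembly] Pure logic over the Statement: obtain (U, δ, μ) from FixedPointDWaveOrder (U ≥ 2 > 0; δ ∈
[1/5, 7/20] ⊂ (0, 1/2)), and for the Statement's (N, ψ) apply SsbToEvenTorusLro U δ μ. Checked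
provable (6-line term/tactic proof) in the planner's Sketch.lean; a prover re-does it in Theorems/.
Sources: Scalapino1995 §2 (order functional), Statement docstring. -/
@[route_item "route-HubbardSuperconductivity-AposterioriCapRg"]
def Assembly : Prop :=
  SsbToEvenTorusLro → FixedPointDWaveOrder → HubbardSuperconductivity

/-- `Assembly` holds: proved by `Summit.HubbardSuperconductivity.HubbardSuperconductivity.Theorems.aposterioriCapRg_assembly_proof`. -/
theorem Assembly_holds : Assembly := _root_.Summit.HubbardSuperconductivity.HubbardSuperconductivity.Theorems.aposterioriCapRg_assembly_proof

-- records of items no longer active in this route (dropped / restated):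
-- earlier KlsOrderOpenness (stmt-HubbardSuperconductivity-1314, dropped 2026-08-15T16:14:51Z): refuted by Summit.HubbardSuperconductivity.HubbardSuperconductivity.Theorems.AposterioriCapRgKlsOrderOpenness_refuted @ cfb05c66cfe1 — ∀ (n r : ℕ), 1 ≤ n → ∃ ε₀ : ℝ, 0 < ε₀ ∧ ∀ (W : ∀ L : ℕ, Literature.MathematicalPhysics.QuantumLattice.Op (Literature.Probability.LatticeModels.TorusSite 2 L) (n + 1)) (ε : 

/-! D-0027 §2.1 — DECIDING THEOREM (planner-authored via `route open/edit --closes-file`; by planner-rbadge-HubbardSuperconductivity-Aposte-93175676-g3-0 2026-08-16T05:21:06Z):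
its hypotheses are this route's items and its conclusion the sub-problem Statement (glue_lint), and it elaborates with this file. -/

@[closes "route-HubbardSuperconductivity-AposterioriCapRg"] theorem closes : CapRgSymmetricCertificatePinned → SeededBrokenRegimeBoseFermiPinned → AposterioriOrderCriterionR → SsbToEvenTorusLro → _root_.HubbardSuperconductivity := by
  intro h2 h3 hR hS
  -- step 1 (= support item FixedPointOfCertifiedChain, pure logic): the certified chain [2] → [3] → R delivers the thesis X
  have hT : FixedPointDWaveOrder := by
    obtain ⟨kStar, etaStar, hk, he, hRall⟩ := hR
    obtain ⟨Θ, h3all⟩ := h3 kStar etaStar hk he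
    obtain ⟨U, hU, δ, hδ, μ, hdens, hcert⟩ := h2
    obtain ⟨K, Λ, L₀, hc⟩ := hcert Θ
    obtain ⟨h₀, hh₀, D, hmeets, _hnp, hm₀, hencl⟩ := h3all U hU δ hδ μ hdens K Λ L₀ hc
    have hle := hRall U μ h₀ D hh₀ hencl hmeets
    have hm₀' : (0 : ℝ) < ((D.meanFieldDensity.fst : ℚ) : ℝ) := by exact_mod_cast hm₀
    refine ⟨U, hU, δ, hδ, μ, hdens, ?_⟩
    rw [Literature.MathematicalPhysics.QuantumLattice.hasDWaveOrder_iff]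
    linarith
  -- step 2 (= item Assembly, pure logic): X and the every-ground-state transfer give the Statement
  obtain ⟨U, hU, δ, hδ, μ, hdens, hord⟩ := hT
  have hU0 : (0 : ℝ) < U := by linarith [hU.1]
  have hδ' : δ ∈ Set.Ioo (0 : ℝ) 1 := ⟨by linarith [hδ.1], by linarith [hδ.2]⟩
  unfold HubbardSuperconductivity Literature.Hubbard.DWaveSuperconductivityHubbard
  refine ⟨U, hU0, δ, ⟨by linarith [hδ.1], by linarith [hδ.2]⟩, ?_⟩
  intro N ψ hψ
  exact hS U δ μ hU0 hδ' hdens hord N ψ hψ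

end Summit.HubbardSuperconductivity.HubbardSuperconductivity.Theses.AposterioriCapRg
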